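import Mathlib
import HarnessLib
import Summits.ResolutionOfSingularities.ResolutionOfSingularities.Theses.EquisingularLift

/-!
# `EquisingularLift` — BC2 REDIRECT: typed decomposition along the STRATA seam, with the assembly PROVED (rev b)

Crux-strategist seat `planner-cstrat-stmt-ResolutionOfSingularities-15660-r1-0`, 2026-08-17, crux
`stmt-ResolutionOfSingularities-15660` = `Theses.EquisingularLift.EquisingularLift` (EL), the deciding crux of
route `ResolutionOfSingularities/EquisingularLift`, re-audited RESTATED (judge rj2: as typed, EL ⇔ embedded
resolution of every projective hypersurface over `k̄` in characteristic `p` by blow-ups whose REGULAR centres lift to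
horizontal regular subschemes of a smooth `O`-model — closed points always lift as `W(k)`-sections (refuter R1) — hence
summit-or-harder modulo the classical `HypersurfacesSuffice` and field descent).

A PROVER lands this file VERBATIM as
`Summits/ResolutionOfSingularities/ResolutionOfSingularities/Theorems/EquisingularLiftEquisingularLiftSplit.lean`
(`ledger propose --kind proof --target … --supports stmt-ResolutionOfSingularities-15660`; Theorems/ is prover-only),
and — once the split is applied to the route — closes the generated glue item by
`fun h₁ h₂ => Split.equisingularLift_of_subs h₁ h₂` (the children are filed with the statements of
`Split.LiftableIsolation` / `Split.IsolatedPointDrop` verbatim, so the route decls unfold to them by `Iff.rfl`).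

## The seam: positive-dimensional singular strata first, isolated singular points second

* `Split.LiftableIsolation` (child 1, crux, rank 2). EL's own data — a COMPLETE characteristic-0 DVR `O` with
  ALGEBRAICALLY CLOSED residue field (the intended `W(k̄)[π^{1/e}]`; EL allows any char-0 DVR), a smooth proper
  `q : P → Spec O`, a closed `Y ⊆ P_s` with `V(Y) ≅ H`, a chain of blow-ups of `P` in regular centres off the generic
  point of `Y` (recursor-encoded exactly as in EL) with IRREDUCIBLE special fibre of the blown-up ambient (all centres
  horizontal) — concluding only that the reduced iterated strict transform `V(closure S')` has FINITELY MANY non-regular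
  points, and that at each of them the blown-up AMBIENT has GOOD REDUCTION (`GoodAt`: the ambient stalk is regular and a
  uniformizer of `O` is a regular parameter, `ϖ ∉ 𝔪²` — i.e. `P' → Spec O` is smooth there). "Resolve GENERICALLY ALONG
  EVERY POSITIVE-DIMENSIONAL SINGULAR STRATUM by liftable centres, without parking the leftover points on damaged fibres."
* `Split.IsolatedPointDrop` (child 2, crux, rank 3). From ANY intermediate stage `(P₁, σ₁, S₁)` of such a chain over
  `(P ⊇ Y)` whose reduced strict transform has finitely many but ≥ 1 non-regular points, all at points of good reduction
  of the ambient, a further chain over `(P₁, closure S₁)` (regular centres off the generic point of the strict transform;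
  irreducible total special fibre) makes the number of non-regular points STRICTLY SMALLER, keeping finiteness and good
  reduction at the remaining ones. "Liftable embedded resolution of ISOLATED singular points, one at a time, in a smooth
  `O`-ambient germ": the home of the route's positive evidence (curves = isolated: Ishii 2025 Cor 1.5; rational double
  points lift with their type: Artin 1977) and of its named risk (kangaroo points, Hauser–Perlega 2019; Kollár 2026).
* WHY THE GOOD-REDUCTION CLAUSE (`Cruxes/EquisingularLift/STRATEGY-CENSUS.md`, §N3). Without it child 2 is FALSE by a
  self-inflicted trap that is itself informative for the route: blow up `P = ℙ²_O` along the regular horizontal centre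
  `C = V(x, y² − πz²) ≅ Spec O[√π]` (closure of a conjugate pair of `K(√π)`-points — the "harmless ramified conjugate
  centre" of the route header); with `Y = P_s` the strict transform is `Bl_{(x,y²)} ℙ²_k`, ONE `A₁` point; no further chain
  of horizontal regular blow-ups makes it regular with irreducible special fibre, since the result would be a SMOOTH proper
  `O`-model of a blow-up of `Bl_{2 pts} ℙ²_K`, whose `H²` carries the inertia swap `E₁ ↔ E₂` (smooth proper base change
  forbids ramified `H²`). The clause excludes exactly the damaged-fibre points (`π ∈ 𝔪²` there) and is inherited along
  isomorphic loci, so the induction threads it.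
* `Split.equisingularLift_of_subs : LiftableIsolation → IsolatedPointDrop → EquisingularLift` — PROVED below,
  sorry-free, axioms `propext`/`Classical.choice`/`Quot.sound` (farm rc 0). NOT a conjunction/modus-ponens seam: the
  two chains live over DIFFERENT bases (`(P, Y)` and `(P₁, closure S₁)`) and must be COMPOSED inside EL's
  higher-order recursor encoding, which requires tracking the generic fibre through every blow-up —
  `Chain.fibre`: along a chain from `Y = closure {ξ}` the fibre over `ξ` stays ONE point `ξ'` and the strict transform
  is `closure {ξ'}` (each blow-up is an isomorphism off its centre — GW I Prop. 13.91 (3), `IsBlowup.isIso_morphismRestrict`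
  — and the centre misses the point over `ξ`; three folklore lemmas on morphisms that are isomorphisms over an open,
  inlined because `Literature…EmbeddedResolution`'s import cone is not route-clean); `Chain.comp`: a centre off the
  generic point `ξ₁` of the strict transform is off the generic point of `Y` because `σ₁⁻¹(ξ) = {ξ₁}`; then strong
  induction on the number of non-regular points, carrying the chain, irreducibility, finiteness and the good-reduction
  clause (`IsolatedPointDrop` strictly lowers the count, `Chain.comp` splices the chains, and at count `0` the reduced
  strict transform is regular).

Probes (BC2 (c), seat folder `bc/`; `first | exact? | simpa [X] | (unfold X; simpa) | aesop`, `maxHeartbeats 400000`):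
`LiftableIsolation → ResolutionOfSingularities`, `LiftableIsolation → EquisingularLift`,
`IsolatedPointDrop → ResolutionOfSingularities`, `IsolatedPointDrop → EquisingularLift` all FAIL (deterministic
timeout at `whnf`); BC4 `example : X := by exact?` FAILS for both ("could not close the goal"); converses fail
mechanically too (EL⁺ ⟹ LiftableIsolation holds mathematically for the intended complete `O`). Birth skeletons:
`Cruxes/EquisingularLift/Lines/birth_LiftableIsolation.lean`, `…/birth_IsolatedPointDrop.lean` (rc 0, sorries = stubs
= 2 each; stub probes fail 8/8). Census: `Cruxes/EquisingularLift/STRATEGY-CENSUS.md`; split package: `…/SPLIT.md`.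
-/

open CategoryTheory AlgebraicGeometry TopologicalSpace Topology
open Literature.AlgebraicGeometry.Resolution

namespace Summit.ResolutionOfSingularities.ResolutionOfSingularities.Theses.EquisingularLift

namespace Split

/-! ## The two pieces (statements verbatim as they are filed as route items) -/

/-- **Child 1 (crux, rank 2): LIFTABLE ISOLATION.** For every prime `p`, every algebraically closed `k` of
characteristic `p`, every `n` and every integral closed `H ⊆ ℙⁿ_k` with locally principal ideal: there are a
COMPLETE DVR `O` of characteristic `0` with ALGEBRAICALLY CLOSED residue field, a smooth proper `q : P → Spec O`, a
closed `Y ⊆ P` inside the special fibre with `V(Y) ≅ H`, and `(P', σ, S')` reached from `(P, 𝟙, Y)` by finitely many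
blow-ups in REGULAR centres lying over non-generic points of `Y` (`S'` the iterated strict transform — the induction
principle of `IsEmbeddedTransform`, verbatim as in `EquisingularLift`), such that the special fibre of `P' → Spec O`
is IRREDUCIBLE (all centres horizontal), the reduced closed subscheme on `closure S'` has only FINITELY MANY
non-regular points, and at each of them the ambient `P'` is regular with the uniformizer of `O` a regular parameter
(good reduction of the blown-up ambient there). [cite: Ishii2025, Thm 1.1/Cor 1.5; CossartJannsenSaito2020; Bennett1970;
Kollar2007, §3.13] -/
def LiftableIsolation : Prop :=
  ∀ p : ℕ, p.Prime → ∀ (k : Type) [Field k] [CharP k p] [IsAlgClosed k] (n : ℕ) (H : AlgebraicGeometry.Scheme.{0}) (ι : H ⟶ (Literature.AlgebraicGeometry.Motives.projectiveSpace n k).left), AlgebraicGeometry.IsClosedImmersion ι → AlgebraicGeometry.IsIntegral H → (∀ y : (Literature.AlgebraicGeometry.Motives.projectiveSpace n k).left, ∃ U : (Literature.AlgebraicGeometry.Motives.projectiveSpace n k).left.affineOpens, y ∈ (U : (Literature.AlgebraicGeometry.Motives.projectiveSpace n k).left.Opens) ∧ (ι.ker.ideal U).IsPrincipal) → ∃ (O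 : Type) (_ : CommRing O) (_ : IsDomain O) (_ : IsDiscreteValuationRing O) (_ : CharZero O) (_ : IsAdicComplete (IsLocalRing.maximalIdeal O) O) (_ : IsAlgClosed (IsLocalRing.ResidueField O)) (P P' : AlgebraicGeometry.Scheme.{0}) (q : P ⟶ AlgebraicGeometry.Spec (.of O)) (Y : TopologicalSpace.Closeds P) (σ : P' ⟶ P) (S' : Set P'), AlgebraicGeometry.Smooth q ∧ AlgebraicGeometry.IsProper q ∧ (Y : Set P) ⊆ q ⁻¹' {IsLocalRing.closedPoint O} ∧ Nonempty ((AlgebraicGeometry.Scheme.IdealSheafData.vanishingIdeal Y).subscheme ≅ H) ∧ (∀ Q : (∀ X' : AlgebraicGeometry.Scheme.{0}, (X' ⟶ P) → Set X' → Prop), Q P (CategoryTheory.CategoryStruct.id P) (Y : Set P) → (∀ (X' X'' : AlgebraicGeometry.Scheme.{0}) (σ' : X' ⟶ P) (Y' : Set X') (C : X'.IdealSheafData) (τ : X'' ⟶ X'), Q X' σ' Y' → Literature.AlgebraicGeometry.Resolution.IsBlowup τ C → Literature.AlgebraicGeometry.Resolution.Scheme.IsRegular C.subscheme → σ' '' (C.support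 : Set X') ⊆ {x : P | ¬ IsGenericPoint x (Y : Set P)} → Q X'' (CategoryTheory.CategoryStruct.comp τ σ') (closure (τ ⁻¹' (Y' \ (C.support : Set X'))))) → Q P' σ S') ∧ IsIrreducible (((CategoryTheory.CategoryStruct.comp σ q)) ⁻¹' {IsLocalRing.closedPoint O}) ∧ Set.Finite {x : ↥(AlgebraicGeometry.Scheme.IdealSheafData.vanishingIdeal (⟨closure S', isClosed_closure⟩ : TopologicalSpace.Closeds P')).subscheme | ¬ IsRegularLocalRing ((AlgebraicGeometry.Scheme.IdealSheafData.vanishingIdeal (⟨closure S', isClosed_closure⟩ : TopologicalSpace.Closeds P')).subscheme.presheaf.stalk x)} ∧ (∀ x : ↥(AlgebraicGeometry.Scheme.IdealSheafData.vanishingIdeal (⟨closure S', isClosed_closure⟩ : TopologicalSpace.Closeds P')).subscheme, ¬ IsRegularLocalRing ((AlgebraicGeometry.Scheme.IdealSheafData.vanishingIdeal (⟨closure S', isClosed_closure⟩ : TopologicalSpace.Closeds P')).subscheme.presheaf.stalk x) → IsRegularLocalRing (P'.presheaf.stalk ((AlgebraicGeometry.Scheme.IdealSheafData.vanishingIdeal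 (⟨closure S', isClosed_closure⟩ : TopologicalSpace.Closeds P')).subschemeι x)) ∧ ∀ ϖ : O, Irreducible ϖ → (P'.presheaf.Γgerm ((AlgebraicGeometry.Scheme.IdealSheafData.vanishingIdeal (⟨closure S', isClosed_closure⟩ : TopologicalSpace.Closeds P')).subschemeι x)).hom (((CategoryTheory.CategoryStruct.comp σ q)).appTop.hom ((AlgebraicGeometry.Scheme.ΓSpecIso (CommRingCat.of O)).inv.hom ϖ)) ∉ (IsLocalRing.maximalIdeal (P'.presheaf.stalk ((AlgebraicGeometry.Scheme.IdealSheafData.vanishingIdeal (⟨closure S', isClosed_closure⟩ : TopologicalSpace.Closeds P')).subschemeι x))) ^ 2)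

/-- **Child 2 (crux, rank 3): ISOLATED POINT DROP.** For every complete DVR `O` of characteristic `0` with
algebraically closed residue field, every smooth proper `q : P → Spec O`, every IRREDUCIBLE closed `Y ⊆ P` inside the
special fibre, and every `(P₁, σ₁, S₁)` reached from `(P, 𝟙, Y)` by a chain of blow-ups in regular centres off the
generic point of `Y` with irreducible special fibre of `P₁ → Spec O`: if the reduced closed subscheme on `closure S₁`
has finitely many and at least one non-regular point, and the ambient `P₁` has good reduction at each of them (regular,
uniformizer a regular parameter), then some `(P₂, σ₂, S₂)` reached from `(P₁, 𝟙, closure S₁)` by a chain of blow-ups in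
regular centres off the generic point of `closure S₁`, with irreducible special fibre of `P₂ → P₁ → P → Spec O`, has a
reduced closed subscheme on `closure S₂` with finitely many and STRICTLY FEWER non-regular points, the ambient `P₂` again
having good reduction at each of them. [cite: Artin1977; Ishii2025, Cor 1.5; HauserPerlega2019, §3; Kollar2026;
arXiv:1005.4503, Thm 5] -/
def IsolatedPointDrop : Prop :=
  ∀ (O : Type) [CommRing O] [IsDomain O] [IsDiscreteValuationRing O] [CharZero O] [IsAdicComplete (IsLocalRing.maximalIdeal O) O] [IsAlgClosed (IsLocalRing.ResidueField O)] (P P₁ : AlgebraicGeometry.Scheme.{0}) (q : P ⟶ AlgebraicGeometry.Spec (.of O)) (Y : TopologicalSpace.Closeds P) (σ₁ : P₁ ⟶ P) (S₁ : Set P₁), AlgebraicGeometry.Smooth q → AlgebraicGeometry.IsProper q → (Y : Set P) ⊆ q ⁻¹' {IsLocalRing.closedPoint O} → IsIrreducible (Y : Set P) → (∀ Q : (∀ X' : AlgebraicGeometry.Scheme.{0}, (X' ⟶ P) → Set X' → Prop), Q P (CategoryTheory.CategoryStruct.id P) (Y : Set P) → (∀ (X' X'' : AlgebraicGeometry.Scheme.{0})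 (σ' : X' ⟶ P) (Y' : Set X') (C : X'.IdealSheafData) (τ : X'' ⟶ X'), Q X' σ' Y' → Literature.AlgebraicGeometry.Resolution.IsBlowup τ C → Literature.AlgebraicGeometry.Resolution.Scheme.IsRegular C.subscheme → σ' '' (C.support : Set X') ⊆ {x : P | ¬ IsGenericPoint x (Y : Set P)} → Q X'' (CategoryTheory.CategoryStruct.comp τ σ') (closure (τ ⁻¹' (Y' \ (C.support : Set X'))))) → Q P₁ σ₁ S₁) → IsIrreducible (((CategoryTheory.CategoryStruct.comp σ₁ q)) ⁻¹' {IsLocalRing.closedPoint O}) → Set.Finite {x : ↥(AlgebraicGeometry.Scheme.IdealSheafData.vanishingIdeal (⟨closure S₁, isClosed_closure⟩ : TopologicalSpace.Closeds P₁)).subscheme | ¬ IsRegularLocalRing ((AlgebraicGeometry.Scheme.IdealSheafData.vanishingIdeal (⟨closure S₁, isClosed_closure⟩ : TopologicalSpace.Closeds P₁)).subscheme.presheaf.stalk x)} → (∀ x : ↥(AlgebraicGeometry.Scheme.IdealSheafData.vanishingIdeal (⟨closure S₁, isClosed_closure⟩ : TopologicalSpace.Closeds P₁)).subscheme, ¬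 IsRegularLocalRing ((AlgebraicGeometry.Scheme.IdealSheafData.vanishingIdeal (⟨closure S₁, isClosed_closure⟩ : TopologicalSpace.Closeds P₁)).subscheme.presheaf.stalk x) → IsRegularLocalRing (P₁.presheaf.stalk ((AlgebraicGeometry.Scheme.IdealSheafData.vanishingIdeal (⟨closure S₁, isClosed_closure⟩ : TopologicalSpace.Closeds P₁)).subschemeι x)) ∧ ∀ ϖ : O, Irreducible ϖ → (P₁.presheaf.Γgerm ((AlgebraicGeometry.Scheme.IdealSheafData.vanishingIdeal (⟨closure S₁, isClosed_closure⟩ : TopologicalSpace.Closeds P₁)).subschemeι x)).hom (((CategoryTheory.CategoryStruct.comp σ₁ q)).appTop.hom ((AlgebraicGeometry.Scheme.ΓSpecIso (CommRingCat.of O)).inv.hom ϖ)) ∉ (IsLocalRing.maximalIdeal (P₁.presheaf.stalk ((AlgebraicGeometry.Scheme.IdealSheafData.vanishingIdeal (⟨closure S₁, isClosed_closure⟩ : TopologicalSpace.Closeds P₁)).subschemeι x))) ^ 2) → Set.Nonempty {x : ↥(AlgebraicGeometry.Scheme.IdealSheafData.vanishingIdeal (⟨closure S₁, isClosed_closure⟩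 : TopologicalSpace.Closeds P₁)).subscheme | ¬ IsRegularLocalRing ((AlgebraicGeometry.Scheme.IdealSheafData.vanishingIdeal (⟨closure S₁, isClosed_closure⟩ : TopologicalSpace.Closeds P₁)).subscheme.presheaf.stalk x)} → ∃ (P₂ : AlgebraicGeometry.Scheme.{0}) (σ₂ : P₂ ⟶ P₁) (S₂ : Set P₂), (∀ Q : (∀ X' : AlgebraicGeometry.Scheme.{0}, (X' ⟶ P₁) → Set X' → Prop), Q P₁ (CategoryTheory.CategoryStruct.id P₁) (closure S₁) → (∀ (X' X'' : AlgebraicGeometry.Scheme.{0}) (σ' : X' ⟶ P₁) (Y' : Set X') (C : X'.IdealSheafData) (τ : X'' ⟶ X'), Q X' σ' Y' → Literature.AlgebraicGeometry.Resolution.IsBlowup τ C → Literature.AlgebraicGeometry.Resolution.Scheme.IsRegular C.subscheme → σ' '' (C.support : Set X') ⊆ {x : P₁ | ¬ IsGenericPoint x (closure S₁)} → Q X'' (CategoryTheory.CategoryStruct.comp τ σ') (closure (τ ⁻¹' (Y' \ (C.support : Set X'))))) → Q P₂ σ₂ S₂) ∧ IsIrreducible (((CategoryTheory.CategoryStruct.comp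 (CategoryTheory.CategoryStruct.comp σ₂ σ₁) q)) ⁻¹' {IsLocalRing.closedPoint O}) ∧ Set.Finite {x : ↥(AlgebraicGeometry.Scheme.IdealSheafData.vanishingIdeal (⟨closure S₂, isClosed_closure⟩ : TopologicalSpace.Closeds P₂)).subscheme | ¬ IsRegularLocalRing ((AlgebraicGeometry.Scheme.IdealSheafData.vanishingIdeal (⟨closure S₂, isClosed_closure⟩ : TopologicalSpace.Closeds P₂)).subscheme.presheaf.stalk x)} ∧ (∀ x : ↥(AlgebraicGeometry.Scheme.IdealSheafData.vanishingIdeal (⟨closure S₂, isClosed_closure⟩ : TopologicalSpace.Closeds P₂)).subscheme, ¬ IsRegularLocalRing ((AlgebraicGeometry.Scheme.IdealSheafData.vanishingIdeal (⟨closure S₂, isClosed_closure⟩ : TopologicalSpace.Closeds P₂)).subscheme.presheaf.stalk x) → IsRegularLocalRing (P₂.presheaf.stalk ((AlgebraicGeometry.Scheme.IdealSheafData.vanishingIdeal (⟨closure S₂, isClosed_closure⟩ : TopologicalSpace.Closeds P₂)).subschemeι x)) ∧ ∀ ϖ : O, Irreducible ϖ → (P₂.presheaf.Γgerm ((AlgebraicGeometry.Scheme.IdealSheafData.vanishingIdeal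 (⟨closure S₂, isClosed_closure⟩ : TopologicalSpace.Closeds P₂)).subschemeι x)).hom (((CategoryTheory.CategoryStruct.comp (CategoryTheory.CategoryStruct.comp σ₂ σ₁) q)).appTop.hom ((AlgebraicGeometry.Scheme.ΓSpecIso (CommRingCat.of O)).inv.hom ϖ)) ∉ (IsLocalRing.maximalIdeal (P₂.presheaf.stalk ((AlgebraicGeometry.Scheme.IdealSheafData.vanishingIdeal (⟨closure S₂, isClosed_closure⟩ : TopologicalSpace.Closeds P₂)).subschemeι x))) ^ 2) ∧ Set.ncard {x : ↥(AlgebraicGeometry.Scheme.IdealSheafData.vanishingIdeal (⟨closure S₂, isClosed_closure⟩ : TopologicalSpace.Closeds P₂)).subscheme | ¬ IsRegularLocalRing ((AlgebraicGeometry.Scheme.IdealSheafData.vanishingIdeal (⟨closure S₂, isClosed_closure⟩ : TopologicalSpace.Closeds P₂)).subscheme.presheaf.stalk x)} < Set.ncard {x : ↥(AlgebraicGeometry.Scheme.IdealSheafData.vanishingIdeal (⟨closure S₁, isClosed_closure⟩ : TopologicalSpace.Closeds P₁)).subscheme | ¬ IsRegularLocalRing ((AlgebraicGeometry.Scheme.IdealSheafData.vanishingIdeal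 (⟨closure S₁, isClosed_closure⟩ : TopologicalSpace.Closeds P₁)).subscheme.presheaf.stalk x)}

/-! ## Helper notions used only in the proofs (each unfolds, by `Iff.rfl`, to the inlined text above) -/

/-- The recursor-encoded chain of blow-ups in regular centres off the generic point(s) of `Y`
(verbatim the fifth conjunct of `EquisingularLift`, abstracted in `P, Y, P', σ, S'`). -/
def Chain (P : Scheme.{0}) (Y : Set P) (P' : Scheme.{0}) (σ : P' ⟶ P) (S' : Set P') : Prop :=
  ∀ Q : (∀ X' : AlgebraicGeometry.Scheme.{0}, (X' ⟶ P) → Set X' → Prop),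
    Q P (CategoryTheory.CategoryStruct.id P) Y →
    (∀ (X' X'' : AlgebraicGeometry.Scheme.{0}) (σ' : X' ⟶ P) (Y' : Set X') (C : X'.IdealSheafData)
      (τ : X'' ⟶ X'), Q X' σ' Y' → Literature.AlgebraicGeometry.Resolution.IsBlowup τ C →
      Literature.AlgebraicGeometry.Resolution.Scheme.IsRegular C.subscheme →
      σ' '' (C.support : Set X') ⊆ {x : P | ¬ IsGenericPoint x Y} →
      Q X'' (CategoryTheory.CategoryStruct.comp τ σ') (closure (τ ⁻¹' (Y' \ (C.support : Set X'))))) →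
    Q P' σ S'

/-- The non-regular locus of the reduced closed subscheme on `closure S'`. -/
def singSet {P' : Scheme.{0}} (S' : Set P') : Set ↥((Scheme.IdealSheafData.vanishingIdeal
    (⟨closure S', isClosed_closure⟩ : Closeds P')).subscheme) :=
  {x | ¬ IsRegularLocalRing (((Scheme.IdealSheafData.vanishingIdeal
    (⟨closure S', isClosed_closure⟩ : Closeds P')).subscheme).presheaf.stalk x)}

/-- GOOD REDUCTION OF THE AMBIENT AT A POINT: the ambient `P'` (with structure morphism `r` to `Spec O`) is
regular at `y` and the uniformizer of `O` is a regular PARAMETER there (`ϖ ∉ 𝔪_y²`) — for the `O`-flat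
finite-type stages of a chain this says exactly that `P' → Spec O` is smooth at `y` (regular special fibre at
`y`, residue field of `O` algebraically closed). -/
def GoodAt {O : Type} [CommRing O] {P' : Scheme.{0}} (r : P' ⟶ Spec (.of O)) (y : P') : Prop :=
  IsRegularLocalRing (P'.presheaf.stalk y) ∧
    ∀ ϖ : O, Irreducible ϖ → (P'.presheaf.Γgerm y).hom (r.appTop.hom ((Scheme.ΓSpecIso (.of O)).inv.hom ϖ)) ∉
      (IsLocalRing.maximalIdeal (P'.presheaf.stalk y)) ^ 2

/-- The good-reduction clause of the split: the ambient has good reduction at every NON-REGULAR point of the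
reduced strict transform `V(closure S')`. -/
def GoodSet {O : Type} [CommRing O] {P' : Scheme.{0}} (r : P' ⟶ Spec (.of O)) (S' : Set P') : Prop :=
  ∀ x : ↥((Scheme.IdealSheafData.vanishingIdeal (⟨closure S', isClosed_closure⟩ : Closeds P')).subscheme),
    ¬ IsRegularLocalRing (((Scheme.IdealSheafData.vanishingIdeal
      (⟨closure S', isClosed_closure⟩ : Closeds P')).subscheme).presheaf.stalk x) →
    GoodAt r ((Scheme.IdealSheafData.vanishingIdeal (⟨closure S', isClosed_closure⟩ : Closeds P')).subschemeι x)

/-! ## Generic fibre of a chain: the point over the generic point is unique at every stage -/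

/-- If `g` is an isomorphism over the open `W`, every point of `W` has exactly one preimage.
[folklore; inlined from `Literature…EmbeddedResolution`, whose import cone is not route-clean] -/
theorem existsUnique_preimage {A B : Scheme.{0}} (g : A ⟶ B) {W : B.Opens} (hW : IsIso (g ∣_ W))
    {y : B} (hy : y ∈ W) : ∃! x : A, g x = y := by
  let eW := Scheme.homeoOfIso (asIso (g ∣_ W))
  have he : ∀ z : ↥((Opens.map g.base).obj W), (eW z).1 = g z.1 := fun z =>
    morphismRestrict_base_coe g W z
  let y' : ↥(W : Scheme.{0}) := ⟨y, hy⟩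
  refine ⟨(eW.symm y').1,
    (he _).symm.trans (congrArg Subtype.val (eW.apply_symm_apply y')), ?_⟩
  intro x (hx : g x = y)
  have hxW : x ∈ (Opens.map g.base).obj W := show g x ∈ W by rw [hx]; exact hy
  have hex : eW ⟨x, hxW⟩ = y' := Subtype.ext ((he _).trans hx)
  exact (congrArg Subtype.val (eW.symm_apply_apply ⟨x, hxW⟩)).symm.trans
    (congrArg (fun w => (eW.symm w).1) hex)

/-- If `g` is an isomorphism over the open `W`, images of open subsets of `g ⁻¹ W` are open. [folklore] -/
theorem isOpen_image {A B : Scheme.{0}} (g : A ⟶ B) {W : B.Opens} (hW : IsIso (g ∣_ W))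
    {S : Set A} (hS : IsOpen S) (hSW : S ⊆ ((Opens.map g.base).obj W : Set A)) : IsOpen (g '' S) := by
  let eW := Scheme.homeoOfIso (asIso (g ∣_ W))
  have he : ∀ z : ↥((Opens.map g.base).obj W), (eW z).1 = g z.1 := fun z =>
    morphismRestrict_base_coe g W z
  have himg : g '' S = W.ι '' (eW '' (Scheme.Opens.ι ((Opens.map g.base).obj W) ⁻¹' S)) := by
    ext y
    constructor
    · rintro ⟨x, hx, rfl⟩
      exact ⟨eW ⟨x, hSW hx⟩, ⟨⟨x, hSW hx⟩, hx, rfl⟩, he _⟩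
    · rintro ⟨_, ⟨z, hz, rfl⟩, rfl⟩
      exact ⟨z.1, hz, (he z).symm⟩
  rw [himg]
  exact W.ι.isOpenEmbedding.isOpenMap _
    (eW.isOpenMap _ (hS.preimage (Scheme.Opens.ι ((Opens.map g.base).obj W)).continuous))

/-- If `g` is an isomorphism over the open `W` and `B' ⊆ B`, every point of `g ⁻¹ W` over the closure
of `B'` lies in the closure of `g ⁻¹ B'`. [folklore] -/
theorem preimage_closure_inter_subset {A B : Scheme.{0}} (g : A ⟶ B) {W : B.Opens}
    (hW : IsIso (g ∣_ W)) (B' : Set B) :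
    g ⁻¹' closure B' ∩ ((Opens.map g.base).obj W : Set A) ⊆ closure (g ⁻¹' B') := by
  rintro x ⟨hxB, hxW⟩
  rw [mem_closure_iff]
  intro S hS hxS
  have hS' : IsOpen (g '' (S ∩ ((Opens.map g.base).obj W : Set A))) :=
    isOpen_image g hW (hS.inter ((Opens.map g.base).obj W).isOpen) Set.inter_subset_right
  obtain ⟨_, ⟨o, ⟨hoS, -⟩, rfl⟩, hoB⟩ := mem_closure_iff.mp hxB _ hS' ⟨x, ⟨hxS, hxW⟩, rfl⟩
  exact ⟨o, hoS, hoB⟩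

/-- STRUCTURE LEMMA. Along a chain starting from `Y = closure {ξ}`, the fibre over `ξ` stays a single
point `ξ'` and the iterated strict transform is `closure {ξ'}` (no properness needed: each blow-up is
an isomorphism off its centre, and the centre misses the point over `ξ`). -/
theorem Chain.fibre {P : Scheme.{0}} {Y : Set P} {P' : Scheme.{0}} {σ : P' ⟶ P} {S' : Set P'}
    (h : Chain P Y P' σ S') {ξ : P} (hξ : IsGenericPoint ξ Y) :
    ∃ ξ' : P', σ ⁻¹' {ξ} = {ξ'} ∧ S' = closure {ξ'} := by
  refine h (fun X' σ' Y' => ∃ ξ' : X', σ' ⁻¹' {ξ} = {ξ'} ∧ Y' = closure {ξ'}) ?_ ?_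
  · refine ⟨ξ, ?_, hξ.symm⟩
    ext x
    simp
  · intro X' X'' σ' Y' C τ hQ hτ _ hTC
    obtain ⟨ξ', hfib, hY'⟩ := hQ
    have hξ'σ : σ' ξ' = ξ := by
      have : ξ' ∈ σ' ⁻¹' {ξ} := by rw [hfib]; exact rfl
      simpa using this
    have hξ'C : ξ' ∉ (C.support : Set X') := by
      intro h'
      have := hTC ⟨ξ', h', hξ'σ⟩
      exact this hξ
    let Wc : X'.Opens := ⟨(C.support : Set X')ᶜ, C.support.isClosed.isOpen_compl⟩
    have hWc : IsIso (τ ∣_ Wc) := hτ.isIso_morphismRestrict disjoint_compl_left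
    obtain ⟨ξ₂, hξ₂, huniq⟩ := existsUnique_preimage τ hWc (y := ξ') hξ'C
    have hfibτ : τ ⁻¹' {ξ'} = {ξ₂} := by
      ext z
      simp only [Set.mem_preimage, Set.mem_singleton_iff]
      exact ⟨fun hz => huniq z hz, fun hz => hz ▸ hξ₂⟩
    refine ⟨ξ₂, ?_, ?_⟩
    · rw [show (CategoryStruct.comp τ σ') ⁻¹' {ξ} = τ ⁻¹' (σ' ⁻¹' {ξ}) from by
        ext z; simp, hfib, hfibτ]
    · apply le_antisymm
      · refine closure_minimal ?_ isClosed_closure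
        rintro x ⟨hxY, hxC⟩
        rw [hY'] at hxY
        have hx := preimage_closure_inter_subset τ hWc {ξ'} ⟨hxY, hxC⟩
        rwa [hfibτ] at hx
      · refine closure_mono (Set.singleton_subset_iff.mpr ⟨?_, ?_⟩)
        · rw [hY']
          show τ ξ₂ ∈ closure {ξ'}
          rw [hξ₂]
          exact subset_closure rfl
        · show τ ξ₂ ∉ (C.support : Set X')
          rw [hξ₂]
          exact hξ'C

/-- COMPOSITION LEMMA. A chain over `(P, Y)` followed by a chain over `(P₁, closure S₁)` is a chain over
`(P, Y)`: a centre off the generic point of the strict transform `closure S₁ = closure {ξ₁}` is off the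
generic point `ξ` of `Y`, because the fibre of `σ₁` over `ξ` is `{ξ₁}`. -/
theorem Chain.comp {P : Scheme.{0}} {Y : Set P} {ξ : P} (hξ : IsGenericPoint ξ Y)
    {P₁ : Scheme.{0}} {σ₁ : P₁ ⟶ P} {S₁ : Set P₁} (h₁ : Chain P Y P₁ σ₁ S₁)
    {P₂ : Scheme.{0}} {σ₂ : P₂ ⟶ P₁} {S₂ : Set P₂} (h₂ : Chain P₁ (closure S₁) P₂ σ₂ S₂) :
    Chain P Y P₂ (CategoryStruct.comp σ₂ σ₁) S₂ := by
  obtain ⟨ξ₁, hfib, hS₁⟩ := h₁.fibre hξ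
  have hS₁cl : closure S₁ = S₁ := by rw [hS₁, closure_closure]
  have hgen₁ : IsGenericPoint ξ₁ (closure S₁) := by
    rw [isGenericPoint_def, hS₁, closure_closure]
  intro Q hbase hstep
  have hQ₁ : Q P₁ σ₁ S₁ := h₁ Q hbase hstep
  refine h₂ (fun X' τ T => Q X' (CategoryStruct.comp τ σ₁) T) ?_ ?_
  · simpa [hS₁cl] using hQ₁
  · intro X' X'' τ T C τ' hQ hτ' hC hTC
    have key : (CategoryStruct.comp τ σ₁) '' (C.support : Set X') ⊆ {x : P | ¬ IsGenericPoint x Y} := by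
      rintro _ ⟨c, hc, rfl⟩ hgen
      have h1 : σ₁ (τ c) = ξ := by
        rw [← Scheme.Hom.comp_apply]
        exact hgen.eq hξ
      have h2 : τ c = ξ₁ := by
        have : τ c ∈ σ₁ ⁻¹' {ξ} := h1
        rw [hfib] at this
        simpa using this
      exact hTC ⟨c, hc, rfl⟩ (h2 ▸ hgen₁)
    have := hstep X' X'' (CategoryStruct.comp τ σ₁) T C τ' hQ hτ' hC key
    simpa [Category.assoc] using this

/-! ## The assembly -/

/-- **ASSEMBLY (BC2 redirect)**: `LiftableIsolation → IsolatedPointDrop → EquisingularLift`. -/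
theorem equisingularLift_of_subs (hA : LiftableIsolation) (hB : IsolatedPointDrop) :
    EquisingularLift := by
  classical
  intro p hp k _ _ _ n H ι hι hH hpr
  obtain ⟨O, i1, i2, i3, i4, i5, i6, P, P₁, q, Y, σ₁, S₁, hq, hqp, hY, ⟨e⟩, hch, hirr, hfin, hgood⟩ :=
    hA p hp k n H ι hι hH hpr
  haveI := hH
  -- the generic point of `Y` (image of the generic point of the integral `H ≅ V(Y)`)
  let ι₀ : H ⟶ P := CategoryStruct.comp e.inv (Scheme.IdealSheafData.vanishingIdeal Y).subschemeι
  have hrange : Set.range ι₀ = (Y : Set P) := by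
    rw [← Scheme.IdealSheafData.coe_support_vanishingIdeal Y,
      ← Scheme.IdealSheafData.range_subschemeι]
    ext x
    constructor
    · rintro ⟨h, rfl⟩
      exact ⟨e.inv h, (Scheme.Hom.comp_apply _ _ h).symm⟩
    · rintro ⟨y, rfl⟩
      obtain ⟨h, rfl⟩ := e.inv.surjective y
      exact ⟨h, Scheme.Hom.comp_apply _ _ h⟩
  have hgen : IsGenericPoint (ι₀ (genericPoint H)) (Y : Set P) := by
    have h := (genericPoint_spec H).image ι₀.continuous
    rwa [Set.image_univ, ι₀.isClosedEmbedding.isClosed_range.closure_eq, hrange] at h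
  have hYirr : IsIrreducible (Y : Set P) := by
    have h := (isIrreducible_singleton (x := ι₀ (genericPoint H))).closure
    rwa [hgen] at h
  -- strong induction on the number of non-regular points of the strict transform, carrying the chain, the
  -- irreducibility of the special fibre, finiteness and the good-reduction clause along
  suffices key : ∀ (m : ℕ) (P₁ : Scheme.{0}) (σ₁ : P₁ ⟶ P) (S₁ : Set P₁),
      Chain P (Y : Set P) P₁ σ₁ S₁ →
      IsIrreducible ((CategoryStruct.comp σ₁ q) ⁻¹' {IsLocalRing.closedPoint O}) →
      (singSet S₁).Finite → GoodSet (CategoryStruct.comp σ₁ q) S₁ → (singSet S₁).ncard = m →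
      ∃ (P' : Scheme.{0}) (σ : P' ⟶ P) (S' : Set P'), Chain P (Y : Set P) P' σ S' ∧
        IsIrreducible ((CategoryStruct.comp σ q) ⁻¹' {IsLocalRing.closedPoint O}) ∧
        Scheme.IsRegular (Scheme.IdealSheafData.vanishingIdeal
          (⟨closure S', isClosed_closure⟩ : Closeds P')).subscheme by
    obtain ⟨P', σ, S', h1, h2, h3⟩ := key _ P₁ σ₁ S₁ hch hirr hfin hgood rfl
    refine ⟨O, i1, i2, i3, i4, P, P', q, Y, σ, S', hq, hqp, hY, ⟨e⟩, ?_, h2, h3⟩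
    exact h1
  intro m
  induction m using Nat.strong_induction_on with
  | _ m ih =>
    intro P₁ σ₁ S₁ hch₁ hirr₁ hfin₁ hgood₁ hm
    by_cases hne : (singSet S₁).Nonempty
    · obtain ⟨P₂, σ₂, S₂, hch₂, hirr₂, hfin₂, hgood₂, hlt⟩ :=
        hB O P P₁ q Y σ₁ S₁ hq hqp hY hYirr hch₁ hirr₁ hfin₁ hgood₁ hne
      have hch' : Chain P (Y : Set P) P₂ (CategoryStruct.comp σ₂ σ₁) S₂ := hch₁.comp hgen hch₂
      have hlt' : (singSet S₂).ncard < m := by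
        rw [← hm]
        exact hlt
      exact ih _ hlt' P₂ (CategoryStruct.comp σ₂ σ₁) S₂ hch' hirr₂ hfin₂ hgood₂ rfl
    · refine ⟨P₁, σ₁, S₁, hch₁, hirr₁, fun x => ?_⟩
      by_contra hx
      exact hne ⟨x, hx⟩

end Split

end Summit.ResolutionOfSingularities.ResolutionOfSingularities.Theses.EquisingularLift
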